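import Summits.QuantumFields.YangMills.Theorems.ColdStartUniversalityLatticeLangevinDynkinCellDecomp
import Summits.QuantumFields.YangMills.Theorems.ColdStartUniversalityLatticeLangevinDynkinCellBounds
import Summits.QuantumFields.YangMills.Theorems.ColdStartUniversalityLatticeLangevinDynkinFreeze
import HarnessLib

/-!
# Route `ColdStartUniversality`, rung `stub_fixedCutoffMixing` of K_A1 (stmt-QuantumFields-24809):
# the one-cell estimate of the Taylor route

Helper file (seat `ym-line-csu-p1`, g6) for the `WilsonMeasureLangevinInvariant` wall of the rung
(step 2, Dynkin's formula in expectation for a vector Itô process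
`X_t^i = X_0^i + ∫₀ᵗ bⁱ dr + ∑_k ∫₀ᵗ σ^{ik} dW^k`, bounded progressive coefficients, JOINT filtration
of the Brownian vector `W`).  **One-cell estimate** (`cell_estimate`): for a cell `(u, v]` with
`v - u ≤ 1`, a bounded `𝓕_u`-measurable weight `Z` and second-order Taylor data `(f, g, h, Cf)`
(`g, h` bounded Lipschitz, third-order Taylor remainder `≤ Cf ∑ |Δᵢ|³`),

  `|E[Z (f(X_v) - f(X_u))] - E[Z ∫_{(u,v]} (Lf)_r dr]| ≤ K (v-u) √(v-u)`

with an explicit `K = K(C, Cf, M, d, |ι|)`; from `cell_error_eq`, the freezing lemma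
`abs_integral_freeze_sub_le`, and the bounds of `…DynkinCellBounds`.  No definition, no sorry,
standard axioms.  RECORD-rung plumbing (R3); the Yang–Mills mass gap is NOT proved.
-/

set_option autoImplicit false

noncomputable section

namespace Summit.QuantumFields.YangMills.Theorems.ColdStartUniversality

open MeasureTheory ProbabilityTheory Filter Finset
open scoped NNReal ENNReal Topology
open Literature.Probability.Process

section Vec

variable {Ω : Type*} {mΩ : MeasurableSpace Ω} {P : Measure Ω} [IsProbabilityMeasure P] {d : ℕ}
  {W : ℝ≥0 → Ω → (Fin d → ℝ)} {ι : Type} [Fintype ι]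
  {X : ℝ≥0 → Ω → (ι → ℝ)} {b : ι → ℝ≥0 → Ω → ℝ} {σ J : ι → Fin d → ℝ≥0 → Ω → ℝ} {M : ℝ}
  {f : (ι → ℝ) → ℝ} {g : ι → (ι → ℝ) → ℝ} {h : ι → ι → (ι → ℝ) → ℝ} {Cf : ℝ}
  {u v : ℝ≥0} {Z : Ω → ℝ} {C : ℝ}

/-- **The one-cell estimate.**  `|E[Z(f(X_v) - f(X_u))] - E[Z ∫_{(u,v]} Lf]| ≤ K · (v-u)√(v-u)` for
`v - u ≤ 1`, with `K = n² C M Cf √K₂ + ½ n³ d C M² Cf √K₂ + ½ n² C Cf M² (1 + 2d) + C Cf n √K₂ √K₄`,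
`n = |ι|`, `K₂ = 2M² + 2d²M²`, `K₄ = 8M⁴ + 72d⁴M⁴`. [folklore] -/
theorem cell_estimate (hW : IsBrownianVec W P)
    (hb : ∀ i, IsStronglyProgressive hW.natFiltration (b i))
    (hσ : ∀ i k, IsStronglyProgressive hW.natFiltration (σ i k))
    (hbM : ∀ i r ω, |b i r ω| ≤ M) (hσM : ∀ i k r ω, |σ i k r ω| ≤ M)
    (hJ : ∀ i k, IsItoIntegral (σ i k) (fun r ω => W r ω k) (J i k) hW.natFiltration P)
    (hXm : ∀ i, Measurable fun p : Ω × ℝ ↦ X p.2.toNNReal p.1 i)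
    (hXa : ∀ i t, StronglyMeasurable[hW.natFiltration t] (fun ω ↦ X t ω i))
    (hXeq : ∀ i, ∀ᵐ ω ∂P, ∀ t, X t ω i = X 0 ω i + (∫ r in (0 : ℝ)..t, b i r.toNNReal ω) + ∑ k, J i k t ω)
    (hfc : Continuous f) (hgc : ∀ i, Continuous (g i)) (hhc : ∀ i j, Continuous (h i j))
    (hfB : ∀ y, |f y| ≤ Cf) (hgB : ∀ i y, |g i y| ≤ Cf) (hhB : ∀ i j y, |h i j y| ≤ Cf)
    (hgL : ∀ i y y', |g i y - g i y'| ≤ Cf * ∑ l, |y l - y' l|)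
    (hhL : ∀ i j y y', |h i j y - h i j y'| ≤ Cf * ∑ l, |y l - y' l|)
    (hT : ∀ y Δ : ι → ℝ, |f (y + Δ) - f y - ∑ i, g i y * Δ i - (1 / 2) * ∑ i, ∑ j, h i j y * (Δ i * Δ j)|
      ≤ Cf * ∑ i, |Δ i| ^ 3)
    (huv : u ≤ v) (hδ1 : (v : ℝ) - u ≤ 1)
    (hZ : StronglyMeasurable[hW.natFiltration u] Z) (hC : ∀ ω, |Z ω| ≤ C) :
    |∫ ω, Z ω * (f (X v ω) - f (X u ω)) ∂P -
      ∫ ω, Z ω * (∫ r in Set.Ioc (u : ℝ) v, (∑ i, g i (X r.toNNReal ω) * b i r.toNNReal ω +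
        (1 / 2) * ∑ i, ∑ j, h i j (X r.toNNReal ω) * ∑ k, σ i k r.toNNReal ω * σ j k r.toNNReal ω)) ∂P| ≤
    ((Fintype.card ι : ℝ) ^ 2 * C * M * Cf * Real.sqrt (2 * M ^ 2 + 2 * (d : ℝ) ^ 2 * M ^ 2) +
      (1 / 2) * (Fintype.card ι : ℝ) ^ 3 * d * C * (M * M) * Cf *
        Real.sqrt (2 * M ^ 2 + 2 * (d : ℝ) ^ 2 * M ^ 2) +
      (1 / 2) * (Fintype.card ι : ℝ) ^ 2 * (C * Cf) * (M ^ 2 * (1 + 2 * d)) +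
      C * Cf * (Fintype.card ι) * (Real.sqrt (2 * M ^ 2 + 2 * (d : ℝ) ^ 2 * M ^ 2) *
        Real.sqrt (8 * M ^ 4 + 72 * (d : ℝ) ^ 4 * M ^ 4))) *
      (((v : ℝ) - u) * Real.sqrt ((v : ℝ) - u)) := by
  classical
  -- constants
  obtain ⟨ω₀, -⟩ := nonempty_of_measure_ne_zero (μ := P) (s := Set.univ)
    (by rw [measure_univ]; exact one_ne_zero)
  have hC0 : 0 ≤ C := (abs_nonneg _).trans (hC ω₀)
  have hCf0 : 0 ≤ Cf := (abs_nonneg _).trans (hfB (X u ω₀))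
  set n : ℝ := (Fintype.card ι : ℝ) with hn
  set δ : ℝ := (v : ℝ) - u with hδ
  have hδ0 : 0 ≤ δ := sub_nonneg.2 (NNReal.coe_le_coe.2 huv)
  set sK₂ : ℝ := Real.sqrt (2 * M ^ 2 + 2 * (d : ℝ) ^ 2 * M ^ 2) with hsK₂
  set sK₄ : ℝ := Real.sqrt (8 * M ^ 4 + 72 * (d : ℝ) ^ 4 * M ^ 4) with hsK₄
  set ρ : ℝ := sK₂ * Real.sqrt δ with hρ
  have hsK₂0 : 0 ≤ sK₂ := Real.sqrt_nonneg _
  have hsK₄0 : 0 ≤ sK₄ := Real.sqrt_nonneg _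
  have hρ0 : 0 ≤ ρ := mul_nonneg hsK₂0 (Real.sqrt_nonneg _)
  have hδδ : δ ^ 2 ≤ δ * Real.sqrt δ := by
    have h1 : δ ≤ Real.sqrt δ := by
      rw [Real.le_sqrt hδ0 hδ0]; nlinarith
    calc δ ^ 2 = δ * δ := sq δ
      _ ≤ δ * Real.sqrt δ := mul_le_mul_of_nonneg_left h1 hδ0
  -- measurability basics
  have hbm : ∀ i, Measurable fun p : Ω × ℝ ↦ b i p.2.toNNReal p.1 := fun i ↦
    measurable_toNNReal_of_isStronglyProgressive (hb i)
  have hσm : ∀ i k, Measurable fun p : Ω × ℝ ↦ σ i k p.2.toNNReal p.1 := fun i k ↦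
    measurable_toNNReal_of_isStronglyProgressive (hσ i k)
  have hZmeas : Measurable Z := (hZ.mono (hW.natFiltration.le u)).measurable
  have hZm : AEStronglyMeasurable Z P := (hZ.mono (hW.natFiltration.le u)).aestronglyMeasurable
  have hXum : Measurable[hW.natFiltration u] (X u) :=
    @measurable_pi_lambda Ω ι (fun _ ↦ ℝ) (hW.natFiltration u) _ (X u) (fun i ↦ (hXa i u).measurable)
  have hXt : ∀ (t : ℝ≥0), Measurable (X t) := fun t ↦
    measurable_pi_lambda _ fun i ↦ ((hXa i t).mono (hW.natFiltration.le t)).measurable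
  -- `M ≥ 0` when `ι` is inhabited (all terms vanish otherwise); we record a usable form
  have hMi : ∀ i : ι, 0 ≤ M := fun i ↦ (abs_nonneg _).trans (hbM i 0 ω₀)
  -- increments: integrability and mean oscillation
  have hXint : ∀ l (r : ℝ≥0), Integrable (fun ω ↦ X r ω l - X u ω l) P := by
    intro l r
    rcases le_total u r with hur | hru
    · exact ((incr_moments (x := fun t ω ↦ X t ω l) hW (hb l) (hσ l) (hbM l) (hσM l) (hJ l)
        (hXeq l) hur).1).integrable (by norm_num)
    · have h4 := ((incr_moments (x := fun t ω ↦ X t ω l) hW (hb l) (hσ l) (hbM l) (hσM l) (hJ l)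
        (hXeq l) hru).1).integrable (by norm_num)
      have : (fun ω ↦ X r ω l - X u ω l) = fun ω ↦ -(X u ω l - X r ω l) := by funext ω; ring
      rw [this]; exact h4.neg
  have hXρ : ∀ l (r : ℝ), r ∈ Set.Ioc (u : ℝ) v → ∫ ω, |X r.toNNReal ω l - X u ω l| ∂P ≤ ρ := by
    intro l r hr
    have hur : u ≤ r.toNNReal := by
      rw [← Real.toNNReal_coe (r := u)]; exact Real.toNNReal_le_toNNReal hr.1.le
    have hrv : r.toNNReal ≤ v := by
      rw [← Real.toNNReal_coe (r := v)]; exact Real.toNNReal_le_toNNReal hr.2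
    exact integral_abs_incr_le (x := fun t ω ↦ X t ω l) hW (hb l) (hσ l) (hbM l) (hσM l) (hJ l) (hXeq l)
      hur hrv hδ1
  -- (1) the frozen `g`-terms
  have hT1 : ∀ i, |∫ ω, Z ω * g i (X u ω) * (∫ r in Set.Ioc (u : ℝ) v, b i r.toNNReal ω) ∂P -
      ∫ ω, Z ω * (∫ r in Set.Ioc (u : ℝ) v, g i (X r.toNNReal ω) * b i r.toNNReal ω) ∂P| ≤
      C * M * Cf * n * ρ * δ := fun i ↦
    abs_integral_freeze_sub_le huv hXm hXint hXρ (hbm i) (hbM i) (hgc i) (hgB i) hCf0 (hgL i) hZmeas hC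
  -- (2) the frozen `h`-terms
  have hT2 : ∀ i j k, |∫ ω, Z ω * h i j (X u ω) *
        (∫ r in Set.Ioc (u : ℝ) v, σ i k r.toNNReal ω * σ j k r.toNNReal ω) ∂P -
      ∫ ω, Z ω * (∫ r in Set.Ioc (u : ℝ) v,
        h i j (X r.toNNReal ω) * (σ i k r.toNNReal ω * σ j k r.toNNReal ω)) ∂P| ≤
      C * (M * M) * Cf * n * ρ * δ := by
    intro i j k
    have hcm : Measurable fun p : Ω × ℝ ↦ σ i k p.2.toNNReal p.1 * σ j k p.2.toNNReal p.1 :=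
      (hσm i k).mul (hσm j k)
    have hcM : ∀ r ω, |σ i k r ω * σ j k r ω| ≤ M * M := fun r ω ↦ by
      rw [abs_mul]; exact mul_le_mul (hσM i k r ω) (hσM j k r ω) (abs_nonneg _) (hMi i)
    exact abs_integral_freeze_sub_le (c := fun r ω ↦ σ i k r ω * σ j k r ω) huv hXm hXint hXρ hcm hcM
      (hhc i j) (hhB i j) hCf0 (hhL i j) hZmeas hC
  -- (3) the drift terms
  have hB_ := fun k ↦ martingale_coord hW k
  have hBsq := fun k ↦ martingale_coord_sq_sub hW k
  have hB2 := fun k (r : ℝ≥0) ↦ memLp_two_coord hW r k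
  have hBc := fun k ↦ continuous_coord hW k
  have hJ2 : ∀ i k (r : ℝ≥0), MemLp (J i k r) 2 P := fun i k r ↦
    IsItoIntegral.memLp_two (hB_ k) (hBsq k) (hB2 k) (hBc k) (hσ i k) (sqErr_ne_top_of_bdd (hσM i k))
      (hJ i k) r
  have hNint : ∀ i, Integrable (fun ω ↦ ∑ k, (J i k v ω - J i k u ω)) P := fun i ↦
    integrable_finsetSum _ fun k _ ↦ ((hJ2 i k v).sub (hJ2 i k u)).integrable one_le_two
  have hNρ : ∀ i, ∫ ω, |∑ k, (J i k v ω - J i k u ω)| ∂P ≤ d * (M * Real.sqrt δ) := fun i ↦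
    integral_abs_martingalePart_le hW (hσ i) (hσM i) (hJ i) (hMi i) huv
  have hT3 : ∀ i j, |∫ ω, Z ω * h i j (X u ω) *
      ((∫ r in Set.Ioc (u : ℝ) v, b i r.toNNReal ω) * (∫ r in Set.Ioc (u : ℝ) v, b j r.toNNReal ω) +
       (∫ r in Set.Ioc (u : ℝ) v, b i r.toNNReal ω) * (∑ k, (J j k v ω - J j k u ω)) +
       (∑ k, (J i k v ω - J i k u ω)) * (∫ r in Set.Ioc (u : ℝ) v, b j r.toNNReal ω)) ∂P| ≤
      C * Cf * ((M * δ) ^ 2 + 2 * ((M * δ) * (d * (M * Real.sqrt δ)))) := by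
    intro i j
    have hG : AEStronglyMeasurable (fun ω ↦ Z ω * h i j (X u ω)) P :=
      hZm.mul ((hhc i j).measurable.comp (hXt u)).aestronglyMeasurable
    have hGb : ∀ ω, |Z ω * h i j (X u ω)| ≤ C * Cf := fun ω ↦ by
      rw [abs_mul]; exact mul_le_mul (hC ω) (hhB i j _) (abs_nonneg _) hC0
    exact abs_integral_driftTerms_le hG hGb (aestronglyMeasurable_setIntegral_Ioc (hbm i))
      (aestronglyMeasurable_setIntegral_Ioc (hbm j)) (fun ω ↦ abs_setIntegral_Ioc_le (hbM i) huv ω)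
      (fun ω ↦ abs_setIntegral_Ioc_le (hbM j) huv ω) (mul_nonneg (hMi i) hδ0) (hNint i) (hNint j)
      (hNρ i) (hNρ j)
  -- (4) the Taylor remainder
  have hΔmom := fun i ↦ incr_moments (x := fun t ω ↦ X t ω i) hW (hb i) (hσ i) (hbM i) (hσM i) (hJ i)
    (hXeq i) huv
  have hΔ3 : ∀ i, ∫ ω, |X v ω i - X u ω i| ^ 3 ∂P ≤ sK₂ * sK₄ * (δ * Real.sqrt δ) := fun i ↦
    integral_abs_incr_pow_three_le (x := fun t ω ↦ X t ω i) hW (hb i) (hσ i) (hbM i) (hσM i) (hJ i)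
      (hXeq i) huv hδ1
  have iΔ3 : ∀ i, Integrable (fun ω ↦ |X v ω i - X u ω i| ^ 3) P := fun i ↦ by
    have := ((hΔmom i).1.mono_exponent (by norm_num : (3 : ℝ≥0∞) ≤ 4)).integrable_norm_pow
      (by norm_num)
    simpa [Real.norm_eq_abs] using this
  have hT4 : |∫ ω, Z ω * (f (X v ω) - f (X u ω) - ∑ i, g i (X u ω) * (X v ω i - X u ω i) -
      (1 / 2) * ∑ i, ∑ j, h i j (X u ω) * ((X v ω i - X u ω i) * (X v ω j - X u ω j))) ∂P| ≤
      C * Cf * (n * (sK₂ * sK₄ * (δ * Real.sqrt δ))) := by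
    have hRb : ∀ ω, |f (X v ω) - f (X u ω) - ∑ i, g i (X u ω) * (X v ω i - X u ω i) -
        (1 / 2) * ∑ i, ∑ j, h i j (X u ω) * ((X v ω i - X u ω i) * (X v ω j - X u ω j))| ≤
        Cf * ∑ i, |X v ω i - X u ω i| ^ 3 := by
      intro ω
      have h := hT (X u ω) (fun i ↦ X v ω i - X u ω i)
      have e : X u ω + (fun i ↦ X v ω i - X u ω i) = X v ω := by funext i; simp
      rw [e] at h
      exact h
    have iS : Integrable (fun ω ↦ C * Cf * ∑ i, |X v ω i - X u ω i| ^ 3) P :=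
      (integrable_finsetSum _ fun i _ ↦ iΔ3 i).const_mul _
    calc |∫ ω, Z ω * (f (X v ω) - f (X u ω) - ∑ i, g i (X u ω) * (X v ω i - X u ω i) -
          (1 / 2) * ∑ i, ∑ j, h i j (X u ω) * ((X v ω i - X u ω i) * (X v ω j - X u ω j))) ∂P|
        ≤ ∫ ω, C * Cf * ∑ i, |X v ω i - X u ω i| ^ 3 ∂P := by
          rw [← Real.norm_eq_abs]
          refine (norm_integral_le_integral_norm _).trans ?_
          refine integral_mono_of_nonneg ?_ iS ?_
          · exact ae_of_all _ fun ω ↦ norm_nonneg _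
          refine ae_of_all _ fun ω ↦ ?_
          simp only
          rw [Real.norm_eq_abs, abs_mul]
          calc |Z ω| * |f (X v ω) - f (X u ω) - ∑ i, g i (X u ω) * (X v ω i - X u ω i) -
                (1 / 2) * ∑ i, ∑ j, h i j (X u ω) * ((X v ω i - X u ω i) * (X v ω j - X u ω j))|
              ≤ C * (Cf * ∑ i, |X v ω i - X u ω i| ^ 3) :=
                mul_le_mul (hC ω) (hRb ω) (abs_nonneg _) hC0
            _ = C * Cf * ∑ i, |X v ω i - X u ω i| ^ 3 := by ring
      _ = C * Cf * ∑ i, ∫ ω, |X v ω i - X u ω i| ^ 3 ∂P := by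
          rw [integral_const_mul, integral_finsetSum _ fun i _ ↦ iΔ3 i]
      _ ≤ C * Cf * ∑ _i : ι, sK₂ * sK₄ * (δ * Real.sqrt δ) :=
          mul_le_mul_of_nonneg_left (sum_le_sum fun i _ ↦ hΔ3 i) (mul_nonneg hC0 hCf0)
      _ = C * Cf * (n * (sK₂ * sK₄ * (δ * Real.sqrt δ))) := by
          rw [sum_const, card_univ, nsmul_eq_mul]
  -- assemble
  rw [cell_error_eq hW hb hσ hbM hσM hJ hXm hXa hXeq hfc hgc hhc hfB hgB hhB huv hZ hC]
  have hS1 : |∑ i, (∫ ω, Z ω * g i (X u ω) * (∫ r in Set.Ioc (u : ℝ) v, b i r.toNNReal ω) ∂P -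
      ∫ ω, Z ω * (∫ r in Set.Ioc (u : ℝ) v, g i (X r.toNNReal ω) * b i r.toNNReal ω) ∂P)| ≤
      n * (C * M * Cf * n * ρ * δ) := by
    refine (abs_sum_le_sum_abs _ _).trans ?_
    refine (sum_le_sum fun i _ ↦ hT1 i).trans ?_
    rw [sum_const, card_univ, nsmul_eq_mul]
  have hS2 : |∑ i, ∑ j, ∑ k,
      (∫ ω, Z ω * h i j (X u ω) * (∫ r in Set.Ioc (u : ℝ) v, σ i k r.toNNReal ω * σ j k r.toNNReal ω) ∂P -
        ∫ ω, Z ω * (∫ r in Set.Ioc (u : ℝ) v,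
          h i j (X r.toNNReal ω) * (σ i k r.toNNReal ω * σ j k r.toNNReal ω)) ∂P)| ≤
      n * (n * (d * (C * (M * M) * Cf * n * ρ * δ))) := by
    refine (abs_sum_le_sum_abs _ _).trans ?_
    refine (sum_le_sum fun i _ ↦ (abs_sum_le_sum_abs _ _).trans
      (sum_le_sum fun j _ ↦ (abs_sum_le_sum_abs _ _).trans (sum_le_sum fun k _ ↦ hT2 i j k))).trans ?_
    simp only [sum_const, card_univ, Fintype.card_fin, nsmul_eq_mul]
    rfl
  have hS3 : |∑ i, ∑ j, ∫ ω, Z ω * h i j (X u ω) *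
      ((∫ r in Set.Ioc (u : ℝ) v, b i r.toNNReal ω) * (∫ r in Set.Ioc (u : ℝ) v, b j r.toNNReal ω) +
       (∫ r in Set.Ioc (u : ℝ) v, b i r.toNNReal ω) * (∑ k, (J j k v ω - J j k u ω)) +
       (∑ k, (J i k v ω - J i k u ω)) * (∫ r in Set.Ioc (u : ℝ) v, b j r.toNNReal ω)) ∂P| ≤
      n * (n * (C * Cf * ((M * δ) ^ 2 + 2 * ((M * δ) * (d * (M * Real.sqrt δ)))))) := by
    refine (abs_sum_le_sum_abs _ _).trans ?_
    refine (sum_le_sum fun i _ ↦ (abs_sum_le_sum_abs _ _).trans (sum_le_sum fun j _ ↦ hT3 i j)).trans ?_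
    simp only [sum_const, card_univ, nsmul_eq_mul]
    rfl
  -- final inequality
  have hM2 : ∀ i : ι, (M * δ) ^ 2 + 2 * ((M * δ) * (d * (M * Real.sqrt δ))) ≤
      M ^ 2 * (1 + 2 * d) * (δ * Real.sqrt δ) := by
    intro i
    have hM0 := hMi i
    have hd : (0 : ℝ) ≤ d := Nat.cast_nonneg d
    have e : (M * δ) ^ 2 + 2 * ((M * δ) * (d * (M * Real.sqrt δ))) =
        M ^ 2 * δ ^ 2 + M ^ 2 * (2 * d) * (δ * Real.sqrt δ) := by ring
    rw [e]
    nlinarith [mul_le_mul_of_nonneg_left hδδ (sq_nonneg M), mul_nonneg (mul_nonneg (sq_nonneg M) hd)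
      (mul_nonneg hδ0 (Real.sqrt_nonneg δ))]
  by_cases hι : Nonempty ι
  · obtain ⟨i₀⟩ := hι
    have hM0 := hMi i₀
    have hd : (0 : ℝ) ≤ d := Nat.cast_nonneg d
    have hn0 : 0 ≤ n := Nat.cast_nonneg _
    have hρδ : ρ * δ = sK₂ * (δ * Real.sqrt δ) := by rw [hρ]; ring
    calc _ ≤ |∑ i, (∫ ω, Z ω * g i (X u ω) * (∫ r in Set.Ioc (u : ℝ) v, b i r.toNNReal ω) ∂P -
            ∫ ω, Z ω * (∫ r in Set.Ioc (u : ℝ) v, g i (X r.toNNReal ω) * b i r.toNNReal ω) ∂P)| +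
          |(1 / 2) * ∑ i, ∑ j, ∑ k,
            (∫ ω, Z ω * h i j (X u ω) *
                (∫ r in Set.Ioc (u : ℝ) v, σ i k r.toNNReal ω * σ j k r.toNNReal ω) ∂P -
              ∫ ω, Z ω * (∫ r in Set.Ioc (u : ℝ) v,
                h i j (X r.toNNReal ω) * (σ i k r.toNNReal ω * σ j k r.toNNReal ω)) ∂P)| +
          |(1 / 2) * ∑ i, ∑ j, ∫ ω, Z ω * h i j (X u ω) *
            ((∫ r in Set.Ioc (u : ℝ) v, b i r.toNNReal ω) * (∫ r in Set.Ioc (u : ℝ) v, b j r.toNNReal ω) +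
             (∫ r in Set.Ioc (u : ℝ) v, b i r.toNNReal ω) * (∑ k, (J j k v ω - J j k u ω)) +
             (∑ k, (J i k v ω - J i k u ω)) * (∫ r in Set.Ioc (u : ℝ) v, b j r.toNNReal ω)) ∂P| +
          |∫ ω, Z ω * (f (X v ω) - f (X u ω) - ∑ i, g i (X u ω) * (X v ω i - X u ω i) -
            (1 / 2) * ∑ i, ∑ j, h i j (X u ω) * ((X v ω i - X u ω i) * (X v ω j - X u ω j))) ∂P| :=
          (abs_add_le _ _).trans (add_le_add ((abs_add_le _ _).trans
            (add_le_add (abs_add_le _ _) le_rfl)) le_rfl)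
      _ ≤ n * (C * M * Cf * n * ρ * δ) + (1 / 2) * (n * (n * (d * (C * (M * M) * Cf * n * ρ * δ)))) +
          (1 / 2) * (n * (n * (C * Cf * (M ^ 2 * (1 + 2 * d) * (δ * Real.sqrt δ))))) +
          C * Cf * (n * (sK₂ * sK₄ * (δ * Real.sqrt δ))) := by
          have h2' : |(1 / 2) * ∑ i, ∑ j, ∑ k,
              (∫ ω, Z ω * h i j (X u ω) *
                  (∫ r in Set.Ioc (u : ℝ) v, σ i k r.toNNReal ω * σ j k r.toNNReal ω) ∂P -
                ∫ ω, Z ω * (∫ r in Set.Ioc (u : ℝ) v,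
                  h i j (X r.toNNReal ω) * (σ i k r.toNNReal ω * σ j k r.toNNReal ω)) ∂P)| ≤
              (1 / 2) * (n * (n * (d * (C * (M * M) * Cf * n * ρ * δ)))) := by
            rw [abs_mul, abs_of_pos (by norm_num : (0 : ℝ) < 1 / 2)]
            exact mul_le_mul_of_nonneg_left hS2 (by norm_num)
          have h3' : |(1 / 2) * ∑ i, ∑ j, ∫ ω, Z ω * h i j (X u ω) *
              ((∫ r in Set.Ioc (u : ℝ) v, b i r.toNNReal ω) * (∫ r in Set.Ioc (u : ℝ) v, b j r.toNNReal ω) +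
               (∫ r in Set.Ioc (u : ℝ) v, b i r.toNNReal ω) * (∑ k, (J j k v ω - J j k u ω)) +
               (∑ k, (J i k v ω - J i k u ω)) * (∫ r in Set.Ioc (u : ℝ) v, b j r.toNNReal ω)) ∂P| ≤
              (1 / 2) * (n * (n * (C * Cf * (M ^ 2 * (1 + 2 * d) * (δ * Real.sqrt δ))))) := by
            rw [abs_mul, abs_of_pos (by norm_num : (0 : ℝ) < 1 / 2)]
            refine mul_le_mul_of_nonneg_left (hS3.trans ?_) (by norm_num)
            exact mul_le_mul_of_nonneg_left (mul_le_mul_of_nonneg_left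
              (mul_le_mul_of_nonneg_left (hM2 i₀) (mul_nonneg hC0 hCf0)) hn0) hn0
          exact add_le_add (add_le_add (add_le_add hS1 h2') h3') hT4
      _ = _ := by rw [hρ]; ring
  · -- empty index type: all sums vanish and the remainder term is `|∫ Z (f(X_v) - f(X_u))|` with
    -- `X_v = X_u` (functions on an empty type), hence `0`.
    haveI hιe : IsEmpty ι := not_nonempty_iff.1 hι
    have hXe : ∀ ω, X v ω = X u ω := fun ω ↦ funext fun i ↦ (hιe.false i).elim
    have hn0 : n = 0 := by rw [hn]; simp
    simp [univ_eq_empty, hXe, hn0]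

end Vec

end Summit.QuantumFields.YangMills.Theorems.ColdStartUniversality

end
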